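import Mathlib
import HarnessLib
import Summits.KontsevichZagierPeriods.Zeta5Search.BarnesMellinCpow
import Summits.KontsevichZagierPeriods.Zeta5Search.BarnesCube
import Literature.Analysis.SpecialFunctions.HypergeometricEulerIntegral

/-!
# ζ(5) search — Nesterenko's Barnes integral for Euler's `₂F₁` integral, real argument `z < 0` (cell `pub-zeta5`, ct-1 g26)

HONEST FRAMING: systematic search; no irrationality claim unless kernel-certified.  An identity of special functions;
nothing here is an irrationality result, a worthiness exponent or a denominator statement; it discharges no named fact
by itself.

Brick B2 (case `z < 0`) of the lineage's blueprint `HOME/ct-1/g26/VWP-BLUEPRINT.md` for `Zudilin2002.vwp_eq_integral_of_pos`: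
Lemma 2 of Zudilin's note math/0206177 (= Nesterenko, *Integral identities and constructions of approximations to zeta
values*, JTNB 15 (2003), §3.2), for a NEGATIVE real argument `z = −ζ`, `ζ > 0` — the case the even-`k` steps of
Zudilin's induction use:

`∫₀¹ t^{a−1}(1−t)^{b−a−1}(1+ζt)^{−a₀} dt = Γ(b−a)/Γ(a₀) · (1/2π) ∫_ℝ Γ(a₀+s)Γ(a+s)Γ(−s)/Γ(b+s) · ζ^{s} dy`, `s = −t₀+iy`,

for complex `a₀, a, b` and a real abscissa `t₀` with `0 < t₀ < Re a₀`, `t₀ < Re a`, `Re a < Re b` (the left-hand side is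
the tree's `Literature.Analysis.SpecialFunctions.Hypergeometric.eulerIntegral a₀ a b (−ζ)`; all powers are Mathlib's
principal-branch `cpow` of positive real bases; the right-hand side is an absolutely convergent Bochner integral over `ℝ`).
Route: the Mellin–Barnes integral for `(1+ζt)^{−a₀}` (`BarnesMellinCpow.mellin_barnes_cpow`, brick B1) under the Euler
integral (`integrand_eq_integral`), Fubini on `(0,1) × ℝ` (`integrable_joint`: the joint integrand is measurable and its
norm IS the product majorant `(t^{Re a−t₀−1}(1−t)^{Re(b−a)−1}·ζ^{−t₀}) · ‖Γ(a₀+s)Γ(−s)/Γ(a₀)‖`, `norm_integrand`, an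
integrable Beta integrand on `(0,1)` times the integrable weight of `BarnesMellinCpow.integrable_Gamma_vertical_cpow'`),
and the inner Beta integral `BarnesCube.integral_beta_Ioo` (`inner_integral`; imported, not restated).  Also
`integrable_barnes_kernel`: the Barnes kernel of the right-hand side is integrable on the line.  The branch `0 < z ≤ 1`
(`(−z)^s = z^s e^{±iπs}`, the odd-`k` steps) is NOT in this file.  Theorems only (no new definitions); imports
`BarnesMellinCpow`, `BarnesCube` (Beta integral on `(0,1)`), `Literature.Analysis.SpecialFunctions.HypergeometricEulerIntegral`.
-/

noncomputable section

namespace Summit.KontsevichZagierPeriods.Zeta5Search.BarnesEulerIntegral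

open MeasureTheory Set Filter
open scoped Real
open Summit.KontsevichZagierPeriods.Zeta5Search.BarnesMellinCpow
open Summit.KontsevichZagierPeriods.Zeta5Search.BarnesCube (integral_beta_Ioo integrableOn_beta_Ioo)
open Literature.Analysis.SpecialFunctions.Hypergeometric (eulerIntegrand eulerIntegral)

variable {ζ t₀ : ℝ} {a₀ a b : ℂ}

/-- The joint integrand on `(0,1) × ℝ` after opening `(1+ζt)^{−a₀}` by the Mellin–Barnes integral:
`F(t,y) = t^{a−1}(1−t)^{b−a−1} · (ζt)^{s} Γ(a₀+s)Γ(−s)/Γ(a₀)`, `s = −t₀+iy` (an abbreviation inside statements only). -/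
theorem integrand_eq_integral (hζ : 0 < ζ) (ht₀ : 0 < t₀) (ht₀' : t₀ < a₀.re) (a b : ℂ) {t : ℝ} (ht : t ∈ Ioo (0 : ℝ) 1) :
    eulerIntegrand a₀ a b (-(ζ : ℂ)) t =
      (1 / (2 * π) : ℂ) * ∫ y : ℝ, (t : ℂ) ^ (a - 1) * (1 - (t : ℂ)) ^ (b - a - 1) *
        ((((ζ * t : ℝ)) : ℂ) ^ (-(t₀ : ℂ) + (y : ℂ) * Complex.I) *
          (Complex.Gamma (a₀ + (-(t₀ : ℂ) + (y : ℂ) * Complex.I)) *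
            Complex.Gamma (-(-(t₀ : ℂ) + (y : ℂ) * Complex.I)) / Complex.Gamma a₀)) := by
  have hw : 0 < ζ * t := mul_pos hζ ht.1
  unfold eulerIntegrand
  rw [show (1 : ℂ) - -(ζ : ℂ) * (t : ℂ) = 1 + (((ζ * t : ℝ)) : ℂ) by push_cast; ring,
    mellin_barnes_cpow a₀ hw ht₀ ht₀', mul_left_comm, ← integral_const_mul]

/-- The Mellin–Barnes weight `y ↦ Γ(a₀+s)Γ(−s)/Γ(a₀)`, `s = −t₀+iy`, is continuous for `0 < t₀ < Re a₀`
(neither Gamma factor meets a pole on the line). -/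
theorem continuous_weight (ht₀ : 0 < t₀) (ht₀' : t₀ < a₀.re) :
    Continuous fun y : ℝ => Complex.Gamma (a₀ + (-(t₀ : ℂ) + (y : ℂ) * Complex.I)) *
      Complex.Gamma (-(-(t₀ : ℂ) + (y : ℂ) * Complex.I)) / Complex.Gamma a₀ := by
  have hc1 : Continuous fun y : ℝ => a₀ + (-(t₀ : ℂ) + (y : ℂ) * Complex.I) := by fun_prop
  have hc2 : Continuous fun y : ℝ => -(-(t₀ : ℂ) + (y : ℂ) * Complex.I) := by fun_prop
  refine (Continuous.mul ?_ ?_).div_const _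
  · refine continuous_iff_continuousAt.mpr fun y => (Complex.continuousAt_Gamma _ ?_).comp hc1.continuousAt
    exact BarnesMellin.ne_neg_nat_of_re_pos (by simp; linarith)
  · refine continuous_iff_continuousAt.mpr fun y => (Complex.continuousAt_Gamma _ ?_).comp hc2.continuousAt
    exact BarnesMellin.ne_neg_nat_of_re_pos (by simp [ht₀])

/-- Norm of the joint integrand on the open square: for `t ∈ (0,1)`,
`‖F(t,y)‖ = (t^{Re a−t₀−1}(1−t)^{Re(b−a)−1} · ζ^{−t₀}) · ‖Γ(a₀+s)Γ(−s)/Γ(a₀)‖`. -/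
theorem norm_integrand (hζ : 0 < ζ) (a₀ a b : ℂ) (t₀ : ℝ) {t : ℝ} (ht : t ∈ Ioo (0 : ℝ) 1) (y : ℝ) :
    ‖(t : ℂ) ^ (a - 1) * (1 - (t : ℂ)) ^ (b - a - 1) *
        ((((ζ * t : ℝ)) : ℂ) ^ (-(t₀ : ℂ) + (y : ℂ) * Complex.I) *
          (Complex.Gamma (a₀ + (-(t₀ : ℂ) + (y : ℂ) * Complex.I)) *
            Complex.Gamma (-(-(t₀ : ℂ) + (y : ℂ) * Complex.I)) / Complex.Gamma a₀))‖ =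
      (‖(t : ℂ) ^ ((a - t₀) - 1) * (1 - (t : ℂ)) ^ ((b - a) - 1)‖ * ζ ^ (-t₀)) *
        ‖Complex.Gamma (a₀ + (-(t₀ : ℂ) + (y : ℂ) * Complex.I)) *
            Complex.Gamma (-(-(t₀ : ℂ) + (y : ℂ) * Complex.I)) / Complex.Gamma a₀‖ := by
  have ht0 : 0 < t := ht.1
  have ht1 : 0 < 1 - t := by linarith [ht.2]
  have hw : 0 < ζ * t := mul_pos hζ ht0
  have e1 : ‖(t : ℂ) ^ (a - 1)‖ = t ^ (a.re - 1) := by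
    rw [Complex.norm_cpow_eq_rpow_re_of_pos ht0]; simp
  have e2 : ‖(1 - (t : ℂ)) ^ (b - a - 1)‖ = (1 - t) ^ (b.re - a.re - 1) := by
    rw [show (1 : ℂ) - (t : ℂ) = ((1 - t : ℝ) : ℂ) by push_cast; ring, Complex.norm_cpow_eq_rpow_re_of_pos ht1]
    simp
  have e3 : ‖(((ζ * t : ℝ)) : ℂ) ^ (-(t₀ : ℂ) + (y : ℂ) * Complex.I)‖ = ζ ^ (-t₀) * t ^ (-t₀) := by
    rw [Complex.norm_cpow_eq_rpow_re_of_pos hw]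
    simp [Real.mul_rpow hζ.le ht0.le]
  have e4 : ‖(t : ℂ) ^ ((a - t₀) - 1)‖ = t ^ (a.re - t₀ - 1) := by
    rw [Complex.norm_cpow_eq_rpow_re_of_pos ht0]; simp
  have e6 : t ^ (a.re - 1) * t ^ (-t₀) = t ^ (a.re - t₀ - 1) := by
    rw [← Real.rpow_add ht0]; ring_nf
  rw [norm_mul, norm_mul, norm_mul, norm_mul, e1, e2, e3, e4, ← e6]
  ring

/-- **Fubini input**: the joint integrand is integrable on `(0,1) × ℝ` (its norm is the Beta integrand
`t^{Re a−t₀−1}(1−t)^{Re(b−a)−1}` times `ζ^{−t₀}` times the integrable weight `‖Γ(a₀+s)Γ(−s)/Γ(a₀)‖`). -/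
theorem integrable_joint (hζ : 0 < ζ) (ht₀ : 0 < t₀) (ht₀' : t₀ < a₀.re) (hta : t₀ < a.re) (hab : a.re < b.re) :
    Integrable (Function.uncurry fun (t : ℝ) (y : ℝ) => (t : ℂ) ^ (a - 1) * (1 - (t : ℂ)) ^ (b - a - 1) *
        ((((ζ * t : ℝ)) : ℂ) ^ (-(t₀ : ℂ) + (y : ℂ) * Complex.I) *
          (Complex.Gamma (a₀ + (-(t₀ : ℂ) + (y : ℂ) * Complex.I)) *
            Complex.Gamma (-(-(t₀ : ℂ) + (y : ℂ) * Complex.I)) / Complex.Gamma a₀)))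
      (((volume : Measure ℝ).restrict (Ioo 0 1)).prod (volume : Measure ℝ)) := by
  -- (a) measurability
  have hGm : Measurable fun y : ℝ => Complex.Gamma (a₀ + (-(t₀ : ℂ) + (y : ℂ) * Complex.I)) *
      Complex.Gamma (-(-(t₀ : ℂ) + (y : ℂ) * Complex.I)) / Complex.Gamma a₀ := (continuous_weight ht₀ ht₀').measurable
  have h1m : Measurable fun t : ℝ => (t : ℂ) ^ (a - 1) * (1 - (t : ℂ)) ^ (b - a - 1) := by fun_prop
  have hwm : Measurable fun t : ℝ => (((ζ * t : ℝ)) : ℂ) := by fun_prop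
  have hsm : Measurable fun z : ℝ × ℝ => -(t₀ : ℂ) + (z.2 : ℂ) * Complex.I := by fun_prop
  have hmeas : Measurable (Function.uncurry fun (t : ℝ) (y : ℝ) => (t : ℂ) ^ (a - 1) * (1 - (t : ℂ)) ^ (b - a - 1) *
        ((((ζ * t : ℝ)) : ℂ) ^ (-(t₀ : ℂ) + (y : ℂ) * Complex.I) *
          (Complex.Gamma (a₀ + (-(t₀ : ℂ) + (y : ℂ) * Complex.I)) *
            Complex.Gamma (-(-(t₀ : ℂ) + (y : ℂ) * Complex.I)) / Complex.Gamma a₀))) :=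
    (h1m.comp measurable_fst).mul (((hwm.comp measurable_fst).pow hsm).mul (hGm.comp measurable_snd))
  -- (b) domination by a product of integrable functions
  have hΦ : Integrable (fun t : ℝ => ‖(t : ℂ) ^ ((a - t₀) - 1) * (1 - (t : ℂ)) ^ ((b - a) - 1)‖ * ζ ^ (-t₀))
      ((volume : Measure ℝ).restrict (Ioo 0 1)) :=
    ((integrableOn_beta_Ioo (u := a - t₀) (v := b - a) (by simp; linarith) (by simp; linarith)).norm.mul_const _)
  have hΨ : Integrable (fun y : ℝ => ‖Complex.Gamma (a₀ + (-(t₀ : ℂ) + (y : ℂ) * Complex.I)) *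
      Complex.Gamma (-(-(t₀ : ℂ) + (y : ℂ) * Complex.I)) / Complex.Gamma a₀‖) :=
    ((integrable_Gamma_vertical_cpow' a₀ ht₀ ht₀').div_const _).norm
  refine Integrable.mono' (hΦ.mul_prod hΨ) hmeas.aestronglyMeasurable ?_
  have hμ : (((volume : Measure ℝ).restrict (Ioo 0 1)).prod (volume : Measure ℝ)) =
      ((volume : Measure ℝ).prod (volume : Measure ℝ)).restrict (Ioo 0 1 ×ˢ univ) := by
    rw [← Measure.prod_restrict, Measure.restrict_univ]
  rw [hμ]
  refine ae_restrict_of_forall_mem (measurableSet_Ioo.prod MeasurableSet.univ) ?_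
  rintro ⟨t, y⟩ ⟨ht, -⟩
  simp only [Function.uncurry_apply_pair]
  exact (norm_integrand hζ a₀ a b t₀ ht y).le

/-- **The inner `t`-integral** for fixed `y`: with `s = −t₀+iy`,
`∫₀¹ F(t,y) dt = ζ^{s} · Γ(a+s)Γ(b−a)/Γ(b+s) · Γ(a₀+s)Γ(−s)/Γ(a₀)` (the Beta integral `B(a+s, b−a)`). -/
theorem inner_integral (hζ : 0 < ζ) (hta : t₀ < a.re) (hab : a.re < b.re) (a₀ : ℂ) (y : ℝ) :
    ∫ t in Ioo (0 : ℝ) 1, (t : ℂ) ^ (a - 1) * (1 - (t : ℂ)) ^ (b - a - 1) *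
        ((((ζ * t : ℝ)) : ℂ) ^ (-(t₀ : ℂ) + (y : ℂ) * Complex.I) *
          (Complex.Gamma (a₀ + (-(t₀ : ℂ) + (y : ℂ) * Complex.I)) *
            Complex.Gamma (-(-(t₀ : ℂ) + (y : ℂ) * Complex.I)) / Complex.Gamma a₀)) =
      (ζ : ℂ) ^ (-(t₀ : ℂ) + (y : ℂ) * Complex.I) *
        (Complex.Gamma (a + (-(t₀ : ℂ) + (y : ℂ) * Complex.I)) * Complex.Gamma (b - a) /
          Complex.Gamma (b + (-(t₀ : ℂ) + (y : ℂ) * Complex.I))) *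
        (Complex.Gamma (a₀ + (-(t₀ : ℂ) + (y : ℂ) * Complex.I)) *
          Complex.Gamma (-(-(t₀ : ℂ) + (y : ℂ) * Complex.I)) / Complex.Gamma a₀) := by
  set s : ℂ := -(t₀ : ℂ) + (y : ℂ) * Complex.I with hs
  have hpt : ∀ t ∈ Ioo (0 : ℝ) 1, (t : ℂ) ^ (a - 1) * (1 - (t : ℂ)) ^ (b - a - 1) *
        ((((ζ * t : ℝ)) : ℂ) ^ s * (Complex.Gamma (a₀ + s) * Complex.Gamma (-s) / Complex.Gamma a₀)) =
      ((t : ℂ) ^ ((a + s) - 1) * (1 - (t : ℂ)) ^ ((b - a) - 1)) *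
        ((ζ : ℂ) ^ s * (Complex.Gamma (a₀ + s) * Complex.Gamma (-s) / Complex.Gamma a₀)) := by
    intro t ht
    have ht0 : 0 < t := ht.1
    have htc : (t : ℂ) ≠ 0 := by exact_mod_cast ht0.ne'
    rw [Complex.ofReal_mul, Complex.mul_cpow_ofReal_nonneg hζ.le ht0.le,
      show (a + s) - 1 = (a - 1) + s by ring, Complex.cpow_add (a - 1) s htc]
    ring
  rw [setIntegral_congr_fun measurableSet_Ioo hpt, integral_mul_const,
    integral_beta_Ioo (u := a + s) (v := b - a) (by simp [hs]; linarith) (by simp; linarith),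
    show a + s + (b - a) = b + s by ring]
  ring

/-- **Nesterenko's Lemma 2 for a negative real argument** [Zudilin, math/0206177, Lemma 2; Nesterenko 2003, §3.2]:
for real `ζ > 0`, complex `a₀, a, b` and a real `t₀` with `0 < t₀ < Re a₀`, `t₀ < Re a`, `Re a < Re b`,
`eulerIntegral a₀ a b (−ζ) = ∫₀¹ t^{a−1}(1−t)^{b−a−1}(1+ζt)^{−a₀} dt
  = Γ(b−a)/Γ(a₀) · (1/2π) ∫_ℝ Γ(a₀+s)Γ(a+s)Γ(−s)/Γ(b+s) · ζ^{s} dy`, `s = −t₀+iy`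
(principal-branch complex powers of the positive reals `t`, `1−t`, `1+ζt`, `ζ`; Bochner integral over `ℝ`). -/
theorem eulerIntegral_neg_eq_barnes (hζ : 0 < ζ) (ht₀ : 0 < t₀) (ht₀' : t₀ < a₀.re) (hta : t₀ < a.re)
    (hab : a.re < b.re) :
    eulerIntegral a₀ a b (-(ζ : ℂ)) =
      Complex.Gamma (b - a) / Complex.Gamma a₀ *
        ((1 / (2 * π) : ℂ) * ∫ y : ℝ,
          Complex.Gamma (a₀ + (-(t₀ : ℂ) + (y : ℂ) * Complex.I)) * Complex.Gamma (a + (-(t₀ : ℂ) + (y : ℂ) * Complex.I)) *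
              Complex.Gamma (-(-(t₀ : ℂ) + (y : ℂ) * Complex.I)) /
              Complex.Gamma (b + (-(t₀ : ℂ) + (y : ℂ) * Complex.I)) *
            (ζ : ℂ) ^ (-(t₀ : ℂ) + (y : ℂ) * Complex.I)) := by
  unfold eulerIntegral
  rw [intervalIntegral.integral_of_le zero_le_one, integral_Ioc_eq_integral_Ioo,
    setIntegral_congr_fun measurableSet_Ioo (fun t ht => integrand_eq_integral hζ ht₀ ht₀' a b ht),
    integral_const_mul, integral_integral_swap (integrable_joint hζ ht₀ ht₀' hta hab)]
  have hin : ∀ y : ℝ, ∫ t in Ioo (0 : ℝ) 1, (t : ℂ) ^ (a - 1) * (1 - (t : ℂ)) ^ (b - a - 1) *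
        ((((ζ * t : ℝ)) : ℂ) ^ (-(t₀ : ℂ) + (y : ℂ) * Complex.I) *
          (Complex.Gamma (a₀ + (-(t₀ : ℂ) + (y : ℂ) * Complex.I)) *
            Complex.Gamma (-(-(t₀ : ℂ) + (y : ℂ) * Complex.I)) / Complex.Gamma a₀)) =
      Complex.Gamma (b - a) / Complex.Gamma a₀ *
        (Complex.Gamma (a₀ + (-(t₀ : ℂ) + (y : ℂ) * Complex.I)) * Complex.Gamma (a + (-(t₀ : ℂ) + (y : ℂ) * Complex.I)) *
            Complex.Gamma (-(-(t₀ : ℂ) + (y : ℂ) * Complex.I)) /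
            Complex.Gamma (b + (-(t₀ : ℂ) + (y : ℂ) * Complex.I)) *
          (ζ : ℂ) ^ (-(t₀ : ℂ) + (y : ℂ) * Complex.I)) := by
    intro y
    rw [inner_integral hζ hta hab a₀ y]
    ring
  rw [show (∫ y : ℝ, ∫ t in Ioo (0 : ℝ) 1, (t : ℂ) ^ (a - 1) * (1 - (t : ℂ)) ^ (b - a - 1) *
        ((((ζ * t : ℝ)) : ℂ) ^ (-(t₀ : ℂ) + (y : ℂ) * Complex.I) *
          (Complex.Gamma (a₀ + (-(t₀ : ℂ) + (y : ℂ) * Complex.I)) *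
            Complex.Gamma (-(-(t₀ : ℂ) + (y : ℂ) * Complex.I)) / Complex.Gamma a₀))) =
      ∫ y : ℝ, Complex.Gamma (b - a) / Complex.Gamma a₀ *
        (Complex.Gamma (a₀ + (-(t₀ : ℂ) + (y : ℂ) * Complex.I)) * Complex.Gamma (a + (-(t₀ : ℂ) + (y : ℂ) * Complex.I)) *
            Complex.Gamma (-(-(t₀ : ℂ) + (y : ℂ) * Complex.I)) /
            Complex.Gamma (b + (-(t₀ : ℂ) + (y : ℂ) * Complex.I)) *
          (ζ : ℂ) ^ (-(t₀ : ℂ) + (y : ℂ) * Complex.I)) from integral_congr_ae (Eventually.of_forall hin),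
    integral_const_mul]
  ring

/-- The Barnes kernel of Lemma 2 is integrable on the line (so the right-hand side above is an honest absolutely
convergent integral): `y ↦ Γ(a₀+s)Γ(a+s)Γ(−s)/Γ(b+s)·ζ^{s}`, `s = −t₀+iy`. -/
theorem integrable_barnes_kernel (hζ : 0 < ζ) (ht₀ : 0 < t₀) (ht₀' : t₀ < a₀.re) (hta : t₀ < a.re)
    (hab : a.re < b.re) :
    Integrable fun y : ℝ =>
      Complex.Gamma (a₀ + (-(t₀ : ℂ) + (y : ℂ) * Complex.I)) * Complex.Gamma (a + (-(t₀ : ℂ) + (y : ℂ) * Complex.I)) *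
          Complex.Gamma (-(-(t₀ : ℂ) + (y : ℂ) * Complex.I)) /
          Complex.Gamma (b + (-(t₀ : ℂ) + (y : ℂ) * Complex.I)) *
        (ζ : ℂ) ^ (-(t₀ : ℂ) + (y : ℂ) * Complex.I) := by
  -- the inner integrals of an integrable joint function are integrable, and equal this kernel up to constants
  have h := (integrable_joint hζ ht₀ ht₀' hta hab).integral_prod_right
  have heq : (fun y : ℝ => ∫ t, (Function.uncurry fun (t : ℝ) (y : ℝ) => (t : ℂ) ^ (a - 1) * (1 - (t : ℂ)) ^ (b - a - 1) *
        ((((ζ * t : ℝ)) : ℂ) ^ (-(t₀ : ℂ) + (y : ℂ) * Complex.I) *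
          (Complex.Gamma (a₀ + (-(t₀ : ℂ) + (y : ℂ) * Complex.I)) *
            Complex.Gamma (-(-(t₀ : ℂ) + (y : ℂ) * Complex.I)) / Complex.Gamma a₀))) (t, y)
        ∂((volume : Measure ℝ).restrict (Ioo 0 1))) =
      fun y : ℝ => Complex.Gamma (b - a) / Complex.Gamma a₀ *
        (Complex.Gamma (a₀ + (-(t₀ : ℂ) + (y : ℂ) * Complex.I)) * Complex.Gamma (a + (-(t₀ : ℂ) + (y : ℂ) * Complex.I)) *
            Complex.Gamma (-(-(t₀ : ℂ) + (y : ℂ) * Complex.I)) /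
            Complex.Gamma (b + (-(t₀ : ℂ) + (y : ℂ) * Complex.I)) *
          (ζ : ℂ) ^ (-(t₀ : ℂ) + (y : ℂ) * Complex.I)) := by
    funext y
    simp only [Function.uncurry_apply_pair]
    rw [inner_integral hζ hta hab a₀ y]
    ring
  rw [heq] at h
  have hc : Complex.Gamma (b - a) / Complex.Gamma a₀ ≠ 0 := by
    refine div_ne_zero (Complex.Gamma_ne_zero_of_re_pos (by simp; linarith)) (Complex.Gamma_ne_zero_of_re_pos (by linarith))
  have := h.const_mul (Complex.Gamma (b - a) / Complex.Gamma a₀)⁻¹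
  refine this.congr (Eventually.of_forall fun y => ?_)
  simp only
  rw [← mul_assoc, inv_mul_cancel₀ hc, one_mul]

end Summit.KontsevichZagierPeriods.Zeta5Search.BarnesEulerIntegral

end
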